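import Mathlib
import HarnessLib
/-!
# Viscous Hou–Luo profile MODEL: the two ORIGIN LAWS and the CHH gauge read-off

HONEST FRAMING (cell ns-blowup GROUP B «PROFILE SEARCH», zone Z3-b′; human rulings D-0035/D-0074): **1-D MODEL (the Hou–Luo
boundary model with Laplacian dissipation added by the cell), pen-and-paper calculus kernel-checked; not Boussinesq, not Euler,
not Navier–Stokes; «violates: none — MODEL».** Nothing in this file is a statement about Navier–Stokes.

OBJECT. The frozen-`ε` profile system of the viscous Hou–Luo model (profile-eng-3 g2 pre-registration; profile-eng-5 g3 engine
`z5hl.py`; companion file `HouLuoFarFieldStagnation.lean` in this directory), with the advection / stretching knobs `a`, `b`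
of the engine kept symbolic:
  `F₁(ξ) ≡ c_ω Ω + c_l ξ Ω′ + a 𝒰 Ω′ − b (HΩ) Ω − P − ε Ω″ = 0`,
  `F₂(ξ) ≡ (2 c_ω + a HΩ) P + c_l ξ P′ + a 𝒰 P′ − ε P″ = 0`,
with `𝒰(0) = 0`, `𝒰′(0) = HΩ(0)`, and `Ω(0) = P(0) = 0` (odd profiles). Hou–Luo is `a = 1`, `b = 0`; the CLM/gCLM-type
stretching term is `b ≠ 0`. (`HouLuoProfileEqAt` of `Literature/Analysis/FluidPDE/HouLuoModelSelfSimilarBlowup.lean`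
[cite: HuangQinWangWei2025HouLuo, eq. (2.1)] is the inviscid case `ε = 0`, `a = 1`, `b = 0` at their `c_ω = −1`.)

WHAT IS KERNEL-CHECKED HERE. Differentiating `F₁ ≡ 0` and `F₂ ≡ 0` once at `ξ = 0` gives the two ORIGIN LAWS that both
cell engines print as acceptance identities at every solved point (eng-3 `origin_law1/2`, eng-5 `origin_law1_defect /
origin_law2_defect`, refuter K-audits STATUS l.3412 / l.3853):
  (law 1) `P′(0) = Ω′(0) (c_ω + c_l + (a − b) HΩ(0)) − ε Ω‴(0)`  (`origin_law1`),
  (law 2) `P′(0) (2 c_ω + c_l + 2 a HΩ(0)) = ε P‴(0)`            (`origin_law2`);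
their INVISCID Hou–Luo corollaries (`ε = 0`, `a = 1`, `b = 0`, `P′(0) ≠ 0`): `HΩ(0) = −(2 c_ω + c_l)/2` and
`P′(0) = (c_l/2) Ω′(0)` — in the gauge `c_ω = 1`: `HΩ(0) = −(2 + c_l)/2`, `P′(0) = (c_l/2) Ω′(0)` (the numbers
`−2.4993520991 / 1.4993520991` at the Chen–Hou–Huang edge `c_l = 2.9987041982` on both engines) — and the GAUGE READ-OFF used by
the Chen–Hou–Huang-normalised dynamic rescaling (both `Ω′(0)` and `P′(0)` conserved; eng-5 `rhs_dyn`): for `b = 0`,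
`Ω′(0) ≠ 0`, `P′(0) ≠ 0`,
  `c_l = 2 (P′(0) + ε Ω‴(0)) / Ω′(0) − ε P‴(0) / P′(0)`,  `c_ω = ε P‴(0) / P′(0) − (P′(0) + ε Ω‴(0)) / Ω′(0) − a HΩ(0)`.
Only the derivatives AT `0` enter: the hypotheses are `HasDerivAt` facts at `0` for `Ω, Ω′, Ω″, P, P′, P″, 𝒰, HΩ` and the
identities `F₁ ≡ 0`, `F₂ ≡ 0` on `ℝ` (as printed by the engines on their grids; pointwise on a neighbourhood would suffice).
WHAT IS NOT PROVED HERE: existence of any profile, smoothness of `HΩ` for a given `Ω`, or `𝒰′ = HΩ` away from `0`; these are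
hypotheses. Only one-variable calculus (product rule at a point) and real algebra; no `def … : Prop` hypotheses.
PLACEMENT: cell-own MODEL lemma under `Summits/NavierStokesRegularity/OSWSelfSimilar/` next to `HouLuoFarFieldStagnation`
(profile-eng-5 g3); bears on LADDER-NS N5 / zone Z3-b′ → N1 linear core (SELFSIM-NOGO M7/M8 bookkeeping on the 1-D MODEL).
-/

namespace Summit.NavierStokesRegularity.OSWSelfSimilar
namespace HouLuoOriginLaws

/-- The `F₂` residual of the frozen-`ε` viscous Hou–Luo profile system as a function of `ξ`, with the profile `P`, its first and
second derivatives `dP`, `ddP`, the Hilbert transform `H = HΩ` and the velocity `U = 𝒰` passed as functions: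
`F₂(ξ) = (2 c_ω + a H(ξ)) P(ξ) + (c_l ξ + a U(ξ)) P′(ξ) − ε P″(ξ)`. [new here — MODEL bookkeeping] -/
noncomputable def F2 (cω cl a ε : ℝ) (H U P dP ddP : ℝ → ℝ) (ξ : ℝ) : ℝ :=
  (2 * cω + a * H ξ) * P ξ + (cl * ξ + a * U ξ) * dP ξ - ε * ddP ξ

/-- The `F₁` residual: `F₁(ξ) = c_ω Ω(ξ) + c_l ξ Ω′(ξ) + a U(ξ) Ω′(ξ) − b H(ξ) Ω(ξ) − P(ξ) − ε Ω″(ξ)`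
(Hou–Luo: `a = 1`, `b = 0`). [new here — MODEL bookkeeping] -/
noncomputable def F1 (cω cl a b ε : ℝ) (H U Om dOm ddOm P : ℝ → ℝ) (ξ : ℝ) : ℝ :=
  cω * Om ξ + cl * ξ * dOm ξ + a * U ξ * dOm ξ - b * H ξ * Om ξ - P ξ - ε * ddOm ξ

/-- **ORIGIN LAW 2.** If `F₂ ≡ 0`, `P(0) = 0`, `𝒰(0) = 0`, `𝒰′(0) = HΩ(0)`, and `P, P′, P″, HΩ` are differentiable at `0`
(`P′(0) = dP 0`, `P″(0) = ddP 0`, `P‴(0) = dddP0`), then `P′(0) (2 c_ω + c_l + 2 a HΩ(0)) = ε P‴(0)`.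
Proof: differentiate `F₂` at `0` (product rule) and use `P(0) = 𝒰(0) = 0`. [new here — MODEL] -/
theorem origin_law2 (cω cl a ε : ℝ) (H U P dP ddP : ℝ → ℝ) (h1 dddP0 : ℝ)
    (hF2 : ∀ ξ, F2 cω cl a ε H U P dP ddP ξ = 0)
    (hP0 : P 0 = 0) (hU0 : U 0 = 0)
    (hP : HasDerivAt P (dP 0) 0) (hdP : HasDerivAt dP (ddP 0) 0) (hddP : HasDerivAt ddP dddP0 0)
    (hH : HasDerivAt H h1 0) (hU : HasDerivAt U (H 0) 0) :
    dP 0 * (2 * cω + cl + 2 * a * H 0) = ε * dddP0 := by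
  have hA : HasDerivAt (fun ξ => 2 * cω + a * H ξ) (a * h1) 0 := (hH.const_mul a).const_add (2 * cω)
  have hAP : HasDerivAt (fun ξ => (2 * cω + a * H ξ) * P ξ) (a * h1 * P 0 + (2 * cω + a * H 0) * dP 0) 0 :=
    hA.mul hP
  have hB : HasDerivAt (fun ξ => cl * ξ + a * U ξ) (cl * 1 + a * H 0) 0 :=
    ((hasDerivAt_id' (0 : ℝ)).const_mul cl).add (hU.const_mul a)
  have hBP : HasDerivAt (fun ξ => (cl * ξ + a * U ξ) * dP ξ)
      ((cl * 1 + a * H 0) * dP 0 + (cl * 0 + a * U 0) * ddP 0) 0 := hB.mul hdP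
  have hC : HasDerivAt (fun ξ => ε * ddP ξ) (ε * dddP0) 0 := hddP.const_mul ε
  have hf : HasDerivAt (F2 cω cl a ε H U P dP ddP)
      (a * h1 * P 0 + (2 * cω + a * H 0) * dP 0 + ((cl * 1 + a * H 0) * dP 0 + (cl * 0 + a * U 0) * ddP 0)
        - ε * dddP0) 0 := by
    have h := (hAP.add hBP).sub hC
    exact h
  have hz : HasDerivAt (F2 cω cl a ε H U P dP ddP) 0 0 := by
    have hfun : F2 cω cl a ε H U P dP ddP = fun _ => (0 : ℝ) := funext hF2
    rw [hfun]
    exact hasDerivAt_const 0 0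
  have huniq := hf.unique hz
  rw [hP0, hU0] at huniq
  linear_combination huniq

/-- **ORIGIN LAW 1.** If `F₁ ≡ 0`, `Ω(0) = 0`, `𝒰(0) = 0`, `𝒰′(0) = HΩ(0)`, and `Ω, Ω′, Ω″, P, HΩ` are differentiable at
`0` (`Ω′(0) = dOm 0`, `Ω″(0) = ddOm 0`, `Ω‴(0) = dddOm0`, `P′(0) = dP0`), then
`P′(0) = Ω′(0) (c_ω + c_l + (a − b) HΩ(0)) − ε Ω‴(0)`. [new here — MODEL] -/
theorem origin_law1 (cω cl a b ε : ℝ) (H U Om dOm ddOm P : ℝ → ℝ) (h1 dddOm0 dP0 : ℝ)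
    (hF1 : ∀ ξ, F1 cω cl a b ε H U Om dOm ddOm P ξ = 0)
    (hOm0 : Om 0 = 0) (hU0 : U 0 = 0)
    (hOm : HasDerivAt Om (dOm 0) 0) (hdOm : HasDerivAt dOm (ddOm 0) 0) (hddOm : HasDerivAt ddOm dddOm0 0)
    (hP : HasDerivAt P dP0 0) (hH : HasDerivAt H h1 0) (hU : HasDerivAt U (H 0) 0) :
    dP0 = dOm 0 * (cω + cl + (a - b) * H 0) - ε * dddOm0 := by
  have hT1 : HasDerivAt (fun ξ => cω * Om ξ) (cω * dOm 0) 0 := hOm.const_mul cω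
  have hT2 : HasDerivAt (fun ξ => cl * ξ * dOm ξ) (cl * 1 * dOm 0 + cl * 0 * ddOm 0) 0 :=
    ((hasDerivAt_id' (0 : ℝ)).const_mul cl).mul hdOm
  have hT3 : HasDerivAt (fun ξ => a * U ξ * dOm ξ) (a * H 0 * dOm 0 + a * U 0 * ddOm 0) 0 :=
    (hU.const_mul a).mul hdOm
  have hT4 : HasDerivAt (fun ξ => b * H ξ * Om ξ) (b * h1 * Om 0 + b * H 0 * dOm 0) 0 :=
    (hH.const_mul b).mul hOm
  have hT6 : HasDerivAt (fun ξ => ε * ddOm ξ) (ε * dddOm0) 0 := hddOm.const_mul ε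
  have hf : HasDerivAt (F1 cω cl a b ε H U Om dOm ddOm P)
      (cω * dOm 0 + (cl * 1 * dOm 0 + cl * 0 * ddOm 0) + (a * H 0 * dOm 0 + a * U 0 * ddOm 0)
        - (b * h1 * Om 0 + b * H 0 * dOm 0) - dP0 - ε * dddOm0) 0 := by
    have h := ((((hT1.add hT2).add hT3).sub hT4).sub hP).sub hT6
    exact h
  have hz : HasDerivAt (F1 cω cl a b ε H U Om dOm ddOm P) 0 0 := by
    have hfun : F1 cω cl a b ε H U Om dOm ddOm P = fun _ => (0 : ℝ) := funext hF1
    rw [hfun]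
    exact hasDerivAt_const 0 0
  have huniq := hf.unique hz
  rw [hOm0, hU0] at huniq
  linear_combination -huniq

/-- **INVISCID HOU–LUO COROLLARY (`ε = 0`, `a = 1`, `b = 0`), scalar form.** From law 2 with `P′(0) ≠ 0`:
`HΩ(0) = −(2 c_ω + c_l)/2`; in the gauge `c_ω = 1` this is the `HΩ(0) = −(2 + c_l)/2 = −2.4993520991` check at the
Chen–Hou–Huang edge `c_l = 2.9987041982` (both engines). [new here — MODEL] -/
theorem hilbert_at_origin_inviscid (cω cl H0 dP0 : ℝ) (hdP0 : dP0 ≠ 0)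
    (hlaw2 : dP0 * (2 * cω + cl + 2 * H0) = 0) : H0 = -(2 * cω + cl) / 2 := by
  have h : 2 * cω + cl + 2 * H0 = 0 := by
    rcases mul_eq_zero.mp hlaw2 with h0 | h0
    · exact absurd h0 hdP0
    · exact h0
  linarith

/-- **INVISCID HOU–LUO COROLLARY, second half, scalar form.** With `HΩ(0) = −(2 c_ω + c_l)/2`, law 1 at `ε = 0`, `a = 1`,
`b = 0` reads `P′(0) = (c_l/2) Ω′(0)` — independently of `c_ω` (`1.4993520991 = 2.9987041982 / 2` at the edge; `Ω′(0)` and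
`P′(0)` have the same sign on the inviscid edge). [new here — MODEL] -/
theorem slope_ratio_inviscid (cω cl H0 dOm0 dP0 : ℝ) (hH0 : H0 = -(2 * cω + cl) / 2)
    (hlaw1 : dP0 = dOm0 * (cω + cl + H0)) : dP0 = cl / 2 * dOm0 := by
  rw [hlaw1, hH0]
  ring

/-- **INVISCID HOU–LUO ORIGIN LAWS, function form.** For the inviscid Hou–Luo profile system (`ε = 0`, `a = 1`, `b = 0`:
`F₁ ≡ 0`, `F₂ ≡ 0`) with odd profiles (`Ω(0) = P(0) = 0`), `𝒰(0) = 0`, `𝒰′(0) = HΩ(0)`, the needed derivatives at `0`,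
and `P′(0) ≠ 0`: `HΩ(0) = −(2 c_ω + c_l)/2` and `P′(0) = (c_l/2) Ω′(0)`. [new here — MODEL] -/
theorem inviscid_origin_laws (cω cl : ℝ) (H U Om dOm ddOm P dP ddP : ℝ → ℝ) (h1 dddOm0 dddP0 : ℝ)
    (hF1 : ∀ ξ, F1 cω cl 1 0 0 H U Om dOm ddOm P ξ = 0) (hF2 : ∀ ξ, F2 cω cl 1 0 H U P dP ddP ξ = 0)
    (hOm0 : Om 0 = 0) (hP0 : P 0 = 0) (hU0 : U 0 = 0)
    (hOm : HasDerivAt Om (dOm 0) 0) (hdOm : HasDerivAt dOm (ddOm 0) 0) (hddOm : HasDerivAt ddOm dddOm0 0)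
    (hP : HasDerivAt P (dP 0) 0) (hdP : HasDerivAt dP (ddP 0) 0) (hddP : HasDerivAt ddP dddP0 0)
    (hH : HasDerivAt H h1 0) (hU : HasDerivAt U (H 0) 0) (hdP0 : dP 0 ≠ 0) :
    H 0 = -(2 * cω + cl) / 2 ∧ dP 0 = cl / 2 * dOm 0 := by
  have l2 := origin_law2 cω cl 1 0 H U P dP ddP h1 dddP0 hF2 hP0 hU0 hP hdP hddP hH hU
  have l1 := origin_law1 cω cl 1 0 0 H U Om dOm ddOm P h1 dddOm0 (dP 0) hF1 hOm0 hU0 hOm hdOm hddOm hP hH hU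
  have hH0 : H 0 = -(2 * cω + cl) / 2 :=
    hilbert_at_origin_inviscid cω cl (H 0) (dP 0) hdP0 (by linear_combination l2)
  refine ⟨hH0, slope_ratio_inviscid cω cl (H 0) (dOm 0) (dP 0) hH0 ?_⟩
  linear_combination l1

/-- **GAUGE READ-OFF (Chen–Hou–Huang normalisation).** For the Hou–Luo system (`b = 0`) the two origin laws determine the
exponents from the derivatives at the origin (law 1 with `b = 0`, law 2): with `Ω′(0) ≠ 0`, `P′(0) ≠ 0`,
`c_l = 2 (P′(0) + ε Ω‴(0)) / Ω′(0) − ε P‴(0) / P′(0)`. This is the formula by which the normalised dynamic rescaling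
(both `Ω′(0)` and `P′(0)` conserved) reads off `c_l(τ)`; at `ε = 0` it is `c_l = 2 P′(0)/Ω′(0)`. [new here — MODEL] -/
theorem cl_readoff (cω cl a ε H0 dOm0 dP0 dddOm0 dddP0 : ℝ) (hdOm0 : dOm0 ≠ 0) (hdP0 : dP0 ≠ 0)
    (hlaw1 : dP0 = dOm0 * (cω + cl + a * H0) - ε * dddOm0)
    (hlaw2 : dP0 * (2 * cω + cl + 2 * a * H0) = ε * dddP0) :
    cl = 2 * (dP0 + ε * dddOm0) / dOm0 - ε * dddP0 / dP0 := by
  have e1 : cω + cl + a * H0 = (dP0 + ε * dddOm0) / dOm0 := by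
    field_simp
    linear_combination -hlaw1
  have e2 : 2 * cω + cl + 2 * a * H0 = ε * dddP0 / dP0 := by
    field_simp
    linear_combination hlaw2
  linear_combination 2 * e1 - e2

/-- **GAUGE READ-OFF, `c_ω`.** Under the same hypotheses `c_ω = ε P‴(0)/P′(0) − (P′(0) + ε Ω‴(0))/Ω′(0) − a HΩ(0)`;
at `ε = 0`: `c_ω = −P′(0)/Ω′(0) − a HΩ(0) = −c_l/2 − a HΩ(0)`. [new here — MODEL] -/
theorem cω_readoff (cω cl a ε H0 dOm0 dP0 dddOm0 dddP0 : ℝ) (hdOm0 : dOm0 ≠ 0) (hdP0 : dP0 ≠ 0)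
    (hlaw1 : dP0 = dOm0 * (cω + cl + a * H0) - ε * dddOm0)
    (hlaw2 : dP0 * (2 * cω + cl + 2 * a * H0) = ε * dddP0) :
    cω = ε * dddP0 / dP0 - (dP0 + ε * dddOm0) / dOm0 - a * H0 := by
  have e1 : cω + cl + a * H0 = (dP0 + ε * dddOm0) / dOm0 := by
    field_simp
    linear_combination -hlaw1
  have e2 : 2 * cω + cl + 2 * a * H0 = ε * dddP0 / dP0 := by
    field_simp
    linear_combination hlaw2
  linear_combination e2 - e1

end HouLuoOriginLaws
end Summit.NavierStokesRegularity.OSWSelfSimilar
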